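import Summits.CriticalPhenomena.PercolationContinuityZ3.Theorems.PercNearOneGluingNoHeavyLowerTailStarSetForestCertificateTools
import HarnessLib

/-!
# `NoHeavyLowerTail` (stmt-CriticalPhenomena-4575) — the FOREST (leaf-peeling) CERTIFICATE, algebraic core

Support file (prover `prim-gen-swap` gen 7; `--supports stmt-CriticalPhenomena-4575`).  No definitions, no named facts, no sorries; Mathlib only.
Generalises `StarSet.nestedCertificate_core` from matchings to FOREST port graphs (seat memo R3-SEATS.md §9): comonotone stars `i ∈ ι`
(linear order = leaf-peeling order) with designated port `d i` and other port `e i`, open with probability `θ_i` independently (pattern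
weights `W`, nested coefficients `c_i = θ_iΠ_{k<i}(1−θ_k)`); FOREST HYPOTHESIS `k < i → e k ∉ {d i, e i}` (excludes parallel stars and
cycles).  Pointwise data: `g ≥ 0`, `ℓ` vanishing off singletons with `ℓ({i}) ≤ 1`, `sp_v ≥ 0`; a lonely star (`ℓ({i}) ≠ 0`) is of type A
(`tA`) or B (`tB`) with the budget events `Z_{d i}`, `E_i` (type A) / `F_i` (type B) inside the lightness events of its ports (`hA`, `hB`), and
lonely stars of different types / two lonely type-B stars never adjacent (`hAB`, `hBB`).  CONCLUSION `StarSet.forestCertificate_core`: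
`Σ_i c_i Σ_σ W(σ)(g(σ) − sp_{d i}(σ)) ≤ Σ_σ W(σ)(g(σ) − ℓ(σ))` — the memo's charging scheme: `Σ_i c_i R_{d i} ≥ Σ_i claim_i` (disjoint budget
events, cylinder sums) and `claim_i ≥ W({i})` (`StarSet.forest_sufficiency`).
-/

namespace Summit.CriticalPhenomena.PercolationContinuityZ3.Theorems

open Finset
open scoped BigOperators

namespace StarSet

variable {ι : Type*} [Fintype ι] [DecidableEq ι]

/-- **Forest certificate, algebraic core.**  See the file header for the notation and the hypotheses. [this file] -/
theorem forestCertificate_core [LinearOrder ι] {V : Type*} [DecidableEq V] (θ : ι → ℝ) (hθ0 : ∀ i, 0 ≤ θ i) (hθ1 : ∀ i, θ i ≤ 1)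
    (d e : ι → V) (hforest : ∀ k i, k < i → e k ≠ d i ∧ e k ≠ e i)
    (g ℓ : Finset ι → ℝ) (sp : V → Finset ι → ℝ) (tA tB : ι → Prop)
    (hg : ∀ σ, 0 ≤ g σ) (hℓ0 : ∀ σ : Finset ι, (∀ i, σ ≠ {i}) → ℓ σ = 0)
    (hℓ1 : ∀ i, ℓ {i} ≤ 1) (hsp : ∀ v σ, 0 ≤ sp v σ)
    (hlonely : ∀ i, ℓ {i} ≠ 0 → tA i ∨ tB i)
    (hA : ∀ i, tA i →
      (∀ σ : Finset ι, (∀ k, (d k = d i ∨ e k = d i) → k ∉ σ) → sp (d i) σ = 1) ∧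
      (∀ σ : Finset ι, i ∈ σ → (∀ k, k ≠ i → (d k = d i ∨ d k = e i ∨ e k = d i ∨ e k = e i) → k ∉ σ) →
        sp (d i) σ = 1 ∧ sp (e i) σ = 1))
    (hB : ∀ i, tB i → ∀ σ : Finset ι, (∀ k, k ≠ i → (d k = d i ∨ d k = e i ∨ e k = d i ∨ e k = e i) → k ∉ σ) →
      sp (d i) σ = 1 ∧ sp (e i) σ = 1)
    (hAB : ∀ k i, tA k → tB i → ¬ (d k = d i ∨ d k = e i ∨ e k = d i ∨ e k = e i))
    (hBB : ∀ i i', i ≠ i' → tB i → tB i' → ¬ (d i = d i' ∨ d i = e i' ∨ e i = d i' ∨ e i = e i')) :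
    ∑ i, (θ i * ∏ j ∈ univ.filter (· < i), (1 - θ j)) *
        ∑ σ ∈ (univ : Finset ι).powerset, ((∏ k ∈ σ, θ k) * ∏ k ∈ univ \ σ, (1 - θ k)) * (g σ - sp (d i) σ) ≤
      ∑ σ ∈ (univ : Finset ι).powerset, ((∏ k ∈ σ, θ k) * ∏ k ∈ univ \ σ, (1 - θ k)) * (g σ - ℓ σ) := by
  classical
  set W : Finset ι → ℝ := fun σ => (∏ k ∈ σ, θ k) * ∏ k ∈ univ \ σ, (1 - θ k) with hW
  set c : ι → ℝ := fun i => θ i * ∏ j ∈ univ.filter (· < i), (1 - θ j) with hc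
  have hWnn : ∀ σ, 0 ≤ W σ := fun σ => mul_nonneg (prod_nonneg fun i _ => hθ0 i) (prod_nonneg fun i _ => sub_nonneg.2 (hθ1 i))
  have hcnn : ∀ i, 0 ≤ c i := fun i => mul_nonneg (hθ0 i) (prod_nonneg fun j _ => sub_nonneg.2 (hθ1 j))
  have hcsum : ∑ i, c i = 1 - ∏ i, (1 - θ i) := by simp only [hc]; rw [prod_one_sub_ordered]; ring
  have hPnn : 0 ≤ ∏ i, (1 - θ i) := prod_nonneg fun i _ => sub_nonneg.2 (hθ1 i)
  set adj : ι → ι → Prop := fun k i => d k = d i ∨ d k = e i ∨ e k = d i ∨ e k = e i with hadj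
  set Nv : V → Finset ι := fun v => univ.filter fun k => d k = v ∨ e k = v with hNv
  set M : ι → Finset ι := fun i => univ.filter fun k => k ≠ i ∧ adj k i with hM
  set Q : ι → Finset ι := fun i => univ.filter fun k => k = i ∨ (k < i ∧ adj k i) with hQ
  have hdesig : ∀ i k, k ∈ Q i → d k = d i ∨ d k = e i := by
    intro i k hk
    simp only [hQ, mem_filter, mem_univ, true_and] at hk
    rcases hk with rfl | ⟨hlt, hkadj⟩
    · exact Or.inl rfl
    · have hf := hforest k i hlt
      rcases hkadj with h | h | h | h
      · exact Or.inl h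
      · exact Or.inr h
      · exact absurd h hf.1
      · exact absurd h hf.2
  -- aggregated quantities
  set G : ℝ := ∑ σ ∈ (univ : Finset ι).powerset, W σ * g σ with hG
  set R : V → ℝ := fun v => ∑ σ ∈ (univ : Finset ι).powerset, W σ * sp v σ with hR
  have hGnn : 0 ≤ G := sum_nonneg fun σ _ => mul_nonneg (hWnn σ) (hg σ)
  -- probabilities of the budget events
  set PZ : V → ℝ := fun v => ∏ k ∈ Nv v, (1 - θ k) with hPZ
  set PE : ι → ℝ := fun i => θ i * ∏ k ∈ M i, (1 - θ k) with hPE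
  set PF : ι → ℝ := fun i => ∏ k ∈ M i, (1 - θ k) with hPF
  have hPZnn : ∀ v, 0 ≤ PZ v := fun v => prod_nonneg fun k _ => sub_nonneg.2 (hθ1 k)
  have hPFnn : ∀ i, 0 ≤ PF i := fun i => prod_nonneg fun k _ => sub_nonneg.2 (hθ1 k)
  have hPEnn : ∀ i, 0 ≤ PE i := fun i => mul_nonneg (hθ0 i) (hPFnn i)
  -- the events as indicators and their pattern sums
  have hZsum : ∀ v, ∑ σ ∈ (univ : Finset ι).powerset, W σ * (if (∀ k, (d k = v ∨ e k = v) → k ∉ σ) then (1 : ℝ) else 0) = PZ v := by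
    intro v
    show _ = ∏ k ∈ Nv v, (1 - θ k)
    rw [← cylinder_sum_closed θ (Nv v)]
    refine sum_congr rfl fun σ _ => ?_
    congr 1
    apply if_congr _ rfl rfl
    simp only [hNv, mem_filter, mem_univ, true_and]
  have hEsum : ∀ i, ∑ σ ∈ (univ : Finset ι).powerset,
      W σ * (if (i ∈ σ ∧ ∀ k, k ≠ i → adj k i → k ∉ σ) then (1 : ℝ) else 0) = PE i := by
    intro i
    have hiM : i ∉ M i := by
      simp only [hM, mem_filter, mem_univ, true_and, not_and]
      exact fun h _ => h rfl
    show _ = θ i * ∏ k ∈ M i, (1 - θ k)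
    rw [← cylinder_sum_one_open θ i (M i) hiM]
    refine sum_congr rfl fun σ _ => ?_
    congr 1
    apply if_congr _ rfl rfl
    simp only [hM, mem_filter, mem_univ, true_and, and_imp]
  have hFsum : ∀ i, ∑ σ ∈ (univ : Finset ι).powerset,
      W σ * (if (∀ k, k ≠ i → adj k i → k ∉ σ) then (1 : ℝ) else 0) = PF i := by
    intro i
    show _ = ∏ k ∈ M i, (1 - θ k)
    rw [← cylinder_sum_closed θ (M i)]
    refine sum_congr rfl fun σ _ => ?_
    congr 1
    apply if_congr _ rfl rfl
    simp only [hM, mem_filter, mem_univ, true_and, and_imp]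
  -- the claims
  set claim : ι → ℝ := fun i =>
    (if tA i then c i * PZ (d i) + (∑ k ∈ Q i, c k) * PE i else 0) + (if tB i then (∑ k ∈ Q i, c k) * PF i else 0) with hclaim
  have hQc_nn : ∀ i, 0 ≤ ∑ k ∈ Q i, c k := fun i => sum_nonneg fun k _ => hcnn k
  have hclaim_nn : ∀ i, 0 ≤ claim i := fun i => add_nonneg
    (by split_ifs; exacts [add_nonneg (mul_nonneg (hcnn i) (hPZnn _)) (mul_nonneg (hQc_nn i) (hPEnn i)), le_refl 0])
    (by split_ifs; exacts [mul_nonneg (hQc_nn i) (hPFnn i), le_refl 0])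
  -- (I) no double booking: `Σ_i claim_i ≤ Σ_i c_i R(d i)`
  have hbudget : ∑ i, claim i ≤ ∑ i, c i * R (d i) := by
    -- pointwise in `σ`: the indicators of the budget events used with the coefficient `c k` are exclusive and imply `sp (d k) σ = 1`
    have hpt : ∀ (k : ι) (σ : Finset ι),
        (if (tA k ∧ ∀ k', (d k' = d k ∨ e k' = d k) → k' ∉ σ) then (1 : ℝ) else 0) +
          ∑ i, ((if (tA i ∧ k ∈ Q i ∧ (i ∈ σ ∧ ∀ k', k' ≠ i → adj k' i → k' ∉ σ)) then (1 : ℝ) else 0) +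
            (if (tB i ∧ k ∈ Q i ∧ ∀ k', k' ≠ i → adj k' i → k' ∉ σ) then (1 : ℝ) else 0)) ≤ sp (d k) σ := by
      intro k σ
      -- which event (if any) holds
      by_cases hZ : tA k ∧ ∀ k', (d k' = d k ∨ e k' = d k) → k' ∉ σ
      · -- Z: then no E_i / F_i with k ∈ Q i
        have hsum0 : ∑ i, ((if (tA i ∧ k ∈ Q i ∧ (i ∈ σ ∧ ∀ k', k' ≠ i → adj k' i → k' ∉ σ)) then (1 : ℝ) else 0) +
            (if (tB i ∧ k ∈ Q i ∧ ∀ k', k' ≠ i → adj k' i → k' ∉ σ) then (1 : ℝ) else 0)) = 0 := by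
          refine sum_eq_zero fun i _ => ?_
          have hE : ¬ (tA i ∧ k ∈ Q i ∧ (i ∈ σ ∧ ∀ k', k' ≠ i → adj k' i → k' ∉ σ)) := by
            rintro ⟨-, hkQ, hiσ, -⟩
            exact hZ.2 i ((hdesig i k hkQ).elim (fun h => Or.inl h.symm) (fun h => Or.inr h.symm)) hiσ
          have hF : ¬ (tB i ∧ k ∈ Q i ∧ ∀ k', k' ≠ i → adj k' i → k' ∉ σ) := by
            rintro ⟨htB, hkQ, -⟩
            refine hAB k i hZ.1 htB ?_
            rcases hdesig i k hkQ with h | h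
            · exact Or.inl h
            · exact Or.inr (Or.inl h)
          rw [if_neg hE, if_neg hF, add_zero]
        rw [if_pos hZ, hsum0, add_zero]
        exact le_of_eq ((hA k hZ.1).1 σ hZ.2).symm
      · rw [if_neg hZ, zero_add]
        -- at most one `i` contributes, and it gives `sp (d k) σ = 1`
        by_cases hex : ∃ i, (tA i ∧ k ∈ Q i ∧ (i ∈ σ ∧ ∀ k', k' ≠ i → adj k' i → k' ∉ σ)) ∨
            (tB i ∧ k ∈ Q i ∧ ∀ k', k' ≠ i → adj k' i → k' ∉ σ)
        · obtain ⟨i₀, hi₀⟩ := hex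
          -- every other index contributes zero
          have hothers : ∀ i, i ≠ i₀ →
              ((if (tA i ∧ k ∈ Q i ∧ (i ∈ σ ∧ ∀ k', k' ≠ i → adj k' i → k' ∉ σ)) then (1 : ℝ) else 0) +
                (if (tB i ∧ k ∈ Q i ∧ ∀ k', k' ≠ i → adj k' i → k' ∉ σ) then (1 : ℝ) else 0)) = 0 := by
            intro i hne
            -- `i` and `i₀` both have the port `d k`, hence are adjacent
            have hadj_of : k ∈ Q i → k ∈ Q i₀ → adj i i₀ := by
              intro h1 h2
              rcases hdesig i k h1 with h | h <;> rcases hdesig i₀ k h2 with h' | h'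
              · exact Or.inl (h.symm.trans h')
              · exact Or.inr (Or.inl (h.symm.trans h'))
              · exact Or.inr (Or.inr (Or.inl (h.symm.trans h')))
              · exact Or.inr (Or.inr (Or.inr (h.symm.trans h')))
            have hadj_symm : ∀ a b, adj a b → adj b a := fun a b h => h.elim (fun h => Or.inl h.symm) fun h =>
              h.elim (fun h => Or.inr (Or.inr (Or.inl h.symm))) fun h =>
                h.elim (fun h => Or.inr (Or.inl h.symm)) fun h => Or.inr (Or.inr (Or.inr h.symm))
            have hkQ₀ : k ∈ Q i₀ := by rcases hi₀ with ⟨-, h, -⟩ | ⟨-, h, -⟩ <;> exact h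
            have hE : ¬ (tA i ∧ k ∈ Q i ∧ (i ∈ σ ∧ ∀ k', k' ≠ i → adj k' i → k' ∉ σ)) := by
              rintro ⟨htA, hkQ, hiσ, hcl⟩
              have ha := hadj_of hkQ hkQ₀
              rcases hi₀ with ⟨-, -, hi₀σ, hcl₀⟩ | ⟨htB₀, -, hcl₀⟩
              · exact hcl₀ i hne ha hiσ
              · exact hAB i i₀ htA htB₀ ha
            have hF : ¬ (tB i ∧ k ∈ Q i ∧ ∀ k', k' ≠ i → adj k' i → k' ∉ σ) := by
              rintro ⟨htB, hkQ, hcl⟩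
              have ha := hadj_of hkQ hkQ₀
              rcases hi₀ with ⟨htA₀, -, hi₀σ, -⟩ | ⟨htB₀, -, -⟩
              · exact hAB i₀ i htA₀ htB (hadj_symm _ _ ha)
              · exact hBB i i₀ hne htB htB₀ ha
            rw [if_neg hE, if_neg hF, add_zero]
          rw [← Finset.add_sum_erase _ _ (mem_univ i₀), Finset.sum_eq_zero (fun i hi => hothers i (Finset.ne_of_mem_erase hi)),
            add_zero]
          -- the contribution of `i₀`
          have hsp1 : sp (d k) σ = 1 := by
            rcases hi₀ with ⟨htA, hkQ, hiσ, hcl⟩ | ⟨htB, hkQ, hcl⟩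
            · have h2 := (hA i₀ htA).2 σ hiσ hcl
              rcases hdesig i₀ k hkQ with h | h
              · rw [h]; exact h2.1
              · rw [h]; exact h2.2
            · have h2 := hB i₀ htB σ hcl
              rcases hdesig i₀ k hkQ with h | h
              · rw [h]; exact h2.1
              · rw [h]; exact h2.2
          rw [hsp1]
          rcases hi₀ with hEi | hFi
          · have hF : ¬ (tB i₀ ∧ k ∈ Q i₀ ∧ ∀ k', k' ≠ i₀ → adj k' i₀ → k' ∉ σ) := by
              rintro ⟨htB, -, -⟩
              exact hAB i₀ i₀ hEi.1 htB (Or.inl rfl)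
            rw [if_pos hEi, if_neg hF, add_zero]
          · have hE : ¬ (tA i₀ ∧ k ∈ Q i₀ ∧ (i₀ ∈ σ ∧ ∀ k', k' ≠ i₀ → adj k' i₀ → k' ∉ σ)) := by
              rintro ⟨htA, -, -⟩
              exact hAB i₀ i₀ htA hFi.1 (Or.inl rfl)
            rw [if_neg hE, if_pos hFi, zero_add]
        · have hex' : ∀ i, ¬ (tA i ∧ k ∈ Q i ∧ (i ∈ σ ∧ ∀ k', k' ≠ i → adj k' i → k' ∉ σ)) ∧
              ¬ (tB i ∧ k ∈ Q i ∧ ∀ k', k' ≠ i → adj k' i → k' ∉ σ) := fun i => not_or.1 (not_exists.1 hex i)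
          rw [Finset.sum_eq_zero (fun i _ => by rw [if_neg (hex' i).1, if_neg (hex' i).2, add_zero])]
          exact hsp (d k) σ
    -- integrate the pointwise bound against `c k · W σ` and rearrange
    have hint : ∀ k, c k * (∑ σ ∈ (univ : Finset ι).powerset, W σ *
        ((if (tA k ∧ ∀ k', (d k' = d k ∨ e k' = d k) → k' ∉ σ) then (1 : ℝ) else 0) +
          ∑ i, ((if (tA i ∧ k ∈ Q i ∧ (i ∈ σ ∧ ∀ k', k' ≠ i → adj k' i → k' ∉ σ)) then (1 : ℝ) else 0) +
            (if (tB i ∧ k ∈ Q i ∧ ∀ k', k' ≠ i → adj k' i → k' ∉ σ) then (1 : ℝ) else 0)))) ≤ c k * R (d k) := by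
      intro k
      refine mul_le_mul_of_nonneg_left (sum_le_sum fun σ _ => mul_le_mul_of_nonneg_left (hpt k σ) (hWnn σ)) (hcnn k)
    have hZk : ∀ k, ∑ σ ∈ (univ : Finset ι).powerset, W σ *
        (if (tA k ∧ ∀ k', (d k' = d k ∨ e k' = d k) → k' ∉ σ) then (1 : ℝ) else 0) = if tA k then PZ (d k) else 0 := by
      intro k
      by_cases htA : tA k
      · rw [if_pos htA, ← hZsum (d k)]
        refine sum_congr rfl fun σ _ => ?_
        congr 1
        exact if_congr (and_iff_right htA) rfl rfl
      · rw [if_neg htA]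
        exact sum_eq_zero fun σ _ => by rw [if_neg (fun h => htA h.1), mul_zero]
    have hEk : ∀ k i, ∑ σ ∈ (univ : Finset ι).powerset, W σ *
        (if (tA i ∧ k ∈ Q i ∧ (i ∈ σ ∧ ∀ k', k' ≠ i → adj k' i → k' ∉ σ)) then (1 : ℝ) else 0) =
        if (tA i ∧ k ∈ Q i) then PE i else 0 := by
      intro k i
      by_cases h : tA i ∧ k ∈ Q i
      · rw [if_pos h, ← hEsum i]
        refine sum_congr rfl fun σ _ => ?_
        congr 1
        exact if_congr ⟨fun h' => h'.2.2, fun h' => ⟨h.1, h.2, h'⟩⟩ rfl rfl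
      · rw [if_neg h]
        exact sum_eq_zero fun σ _ => by rw [if_neg (fun h' => h ⟨h'.1, h'.2.1⟩), mul_zero]
    have hFk : ∀ k i, ∑ σ ∈ (univ : Finset ι).powerset, W σ *
        (if (tB i ∧ k ∈ Q i ∧ ∀ k', k' ≠ i → adj k' i → k' ∉ σ) then (1 : ℝ) else 0) =
        if (tB i ∧ k ∈ Q i) then PF i else 0 := by
      intro k i
      by_cases h : tB i ∧ k ∈ Q i
      · rw [if_pos h, ← hFsum i]
        refine sum_congr rfl fun σ _ => ?_
        congr 1
        exact if_congr ⟨fun h' => h'.2.2, fun h' => ⟨h.1, h.2, h'⟩⟩ rfl rfl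
      · rw [if_neg h]
        exact sum_eq_zero fun σ _ => by rw [if_neg (fun h' => h ⟨h'.1, h'.2.1⟩), mul_zero]
    have hexpand : ∀ k, (∑ σ ∈ (univ : Finset ι).powerset, W σ *
        ((if (tA k ∧ ∀ k', (d k' = d k ∨ e k' = d k) → k' ∉ σ) then (1 : ℝ) else 0) +
          ∑ i, ((if (tA i ∧ k ∈ Q i ∧ (i ∈ σ ∧ ∀ k', k' ≠ i → adj k' i → k' ∉ σ)) then (1 : ℝ) else 0) +
            (if (tB i ∧ k ∈ Q i ∧ ∀ k', k' ≠ i → adj k' i → k' ∉ σ) then (1 : ℝ) else 0)))) =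
        (if tA k then PZ (d k) else 0) +
          ∑ i, ((if (tA i ∧ k ∈ Q i) then PE i else 0) + (if (tB i ∧ k ∈ Q i) then PF i else 0)) := by
      intro k
      calc (∑ σ ∈ (univ : Finset ι).powerset, W σ *
            ((if (tA k ∧ ∀ k', (d k' = d k ∨ e k' = d k) → k' ∉ σ) then (1 : ℝ) else 0) +
              ∑ i, ((if (tA i ∧ k ∈ Q i ∧ (i ∈ σ ∧ ∀ k', k' ≠ i → adj k' i → k' ∉ σ)) then (1 : ℝ) else 0) +
                (if (tB i ∧ k ∈ Q i ∧ ∀ k', k' ≠ i → adj k' i → k' ∉ σ) then (1 : ℝ) else 0))))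
          = ∑ σ ∈ (univ : Finset ι).powerset,
              (W σ * (if (tA k ∧ ∀ k', (d k' = d k ∨ e k' = d k) → k' ∉ σ) then (1 : ℝ) else 0) +
                ∑ i, (W σ * (if (tA i ∧ k ∈ Q i ∧ (i ∈ σ ∧ ∀ k', k' ≠ i → adj k' i → k' ∉ σ)) then (1 : ℝ) else 0) +
                  W σ * (if (tB i ∧ k ∈ Q i ∧ ∀ k', k' ≠ i → adj k' i → k' ∉ σ) then (1 : ℝ) else 0))) := by
            refine sum_congr rfl fun σ _ => ?_
            rw [mul_add, Finset.mul_sum]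
            congr 1
            exact sum_congr rfl fun i _ => by ring
        _ = (∑ σ ∈ (univ : Finset ι).powerset,
              W σ * (if (tA k ∧ ∀ k', (d k' = d k ∨ e k' = d k) → k' ∉ σ) then (1 : ℝ) else 0)) +
              ∑ σ ∈ (univ : Finset ι).powerset,
                ∑ i, (W σ * (if (tA i ∧ k ∈ Q i ∧ (i ∈ σ ∧ ∀ k', k' ≠ i → adj k' i → k' ∉ σ)) then (1 : ℝ) else 0) +
                  W σ * (if (tB i ∧ k ∈ Q i ∧ ∀ k', k' ≠ i → adj k' i → k' ∉ σ) then (1 : ℝ) else 0)) :=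
            Finset.sum_add_distrib
        _ = (∑ σ ∈ (univ : Finset ι).powerset,
              W σ * (if (tA k ∧ ∀ k', (d k' = d k ∨ e k' = d k) → k' ∉ σ) then (1 : ℝ) else 0)) +
              ∑ i, ∑ σ ∈ (univ : Finset ι).powerset,
                (W σ * (if (tA i ∧ k ∈ Q i ∧ (i ∈ σ ∧ ∀ k', k' ≠ i → adj k' i → k' ∉ σ)) then (1 : ℝ) else 0) +
                  W σ * (if (tB i ∧ k ∈ Q i ∧ ∀ k', k' ≠ i → adj k' i → k' ∉ σ) then (1 : ℝ) else 0)) := by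
            rw [Finset.sum_comm]
        _ = _ := by
            rw [hZk k]
            congr 1
            refine sum_congr rfl fun i _ => ?_
            rw [Finset.sum_add_distrib, hEk k i, hFk k i]
    -- `Σ_i claim_i` equals the integrated left side
    have hci : ∀ i, claim i = c i * (if tA i then PZ (d i) else 0) +
        ∑ k, c k * ((if (tA i ∧ k ∈ Q i) then PE i else 0) + (if (tB i ∧ k ∈ Q i) then PF i else 0)) := by
      intro i
      have hsumQ : ∀ (P : Prop) [Decidable P] (x : ℝ),
          ∑ k, c k * (if (P ∧ k ∈ Q i) then x else 0) = if P then (∑ k ∈ Q i, c k) * x else 0 := by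
        intro P _ x
        by_cases hP : P
        · rw [if_pos hP, Finset.sum_mul]
          rw [← Finset.sum_subset (Finset.subset_univ (Q i)) (fun k _ hk => by rw [if_neg (fun h => hk h.2), mul_zero])]
          exact sum_congr rfl fun k hk => by rw [if_pos ⟨hP, hk⟩]
        · rw [if_neg hP]
          exact sum_eq_zero fun k _ => by rw [if_neg (fun h => hP h.1), mul_zero]
      have hsplit : (∑ k, c k * ((if (tA i ∧ k ∈ Q i) then PE i else 0) + (if (tB i ∧ k ∈ Q i) then PF i else 0))) =
          (∑ k, c k * (if (tA i ∧ k ∈ Q i) then PE i else 0)) + ∑ k, c k * (if (tB i ∧ k ∈ Q i) then PF i else 0) := by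
        rw [← Finset.sum_add_distrib]; exact sum_congr rfl fun k _ => by ring
      rw [hsplit, hsumQ (tA i) (PE i), hsumQ (tB i) (PF i)]
      simp only [hclaim]
      by_cases htA : tA i <;> by_cases htB : tB i <;> simp only [htA, htB, if_true, if_false] <;> ring
    calc ∑ i, claim i
        = ∑ i, (c i * (if tA i then PZ (d i) else 0) +
            ∑ k, c k * ((if (tA i ∧ k ∈ Q i) then PE i else 0) + (if (tB i ∧ k ∈ Q i) then PF i else 0))) :=
          sum_congr rfl fun i _ => hci i
      _ = ∑ i, c i * (if tA i then PZ (d i) else 0) +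
            ∑ i, ∑ k, c k * ((if (tA i ∧ k ∈ Q i) then PE i else 0) + (if (tB i ∧ k ∈ Q i) then PF i else 0)) :=
          Finset.sum_add_distrib
      _ = ∑ k, c k * (if tA k then PZ (d k) else 0) +
            ∑ k, ∑ i, c k * ((if (tA i ∧ k ∈ Q i) then PE i else 0) + (if (tB i ∧ k ∈ Q i) then PF i else 0)) := by
          rw [Finset.sum_comm]
      _ = ∑ k, (c k * (if tA k then PZ (d k) else 0) +
            ∑ i, c k * ((if (tA i ∧ k ∈ Q i) then PE i else 0) + (if (tB i ∧ k ∈ Q i) then PF i else 0))) :=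
          Finset.sum_add_distrib.symm
      _ = ∑ k, c k * ((if tA k then PZ (d k) else 0) +
            ∑ i, ((if (tA i ∧ k ∈ Q i) then PE i else 0) + (if (tB i ∧ k ∈ Q i) then PF i else 0))) :=
          sum_congr rfl fun k _ => by rw [mul_add, Finset.mul_sum]
      _ = ∑ k, c k * (∑ σ ∈ (univ : Finset ι).powerset, W σ *
            ((if (tA k ∧ ∀ k', (d k' = d k ∨ e k' = d k) → k' ∉ σ) then (1 : ℝ) else 0) +
              ∑ i, ((if (tA i ∧ k ∈ Q i ∧ (i ∈ σ ∧ ∀ k', k' ≠ i → adj k' i → k' ∉ σ)) then (1 : ℝ) else 0) +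
                (if (tB i ∧ k ∈ Q i ∧ ∀ k', k' ≠ i → adj k' i → k' ∉ σ) then (1 : ℝ) else 0)))) :=
          sum_congr rfl fun k _ => by rw [hexpand k]
      _ ≤ ∑ k, c k * R (d k) := sum_le_sum fun k _ => hint k
  -- (II) sufficiency: `W {i} * ℓ {i} ≤ claim i`
  have hsuff : ∀ i, W {i} * ℓ {i} ≤ claim i := by
    intro i
    by_cases hℓi : ℓ {i} = 0
    · rw [hℓi, mul_zero]; exact hclaim_nn i
    have hWi : W {i} = θ i * ∏ k ∈ univ \ {i}, (1 - θ k) := by simp only [hW, prod_singleton]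
    have hWinn : 0 ≤ W {i} := hWnn {i}
    suffices hmain : W {i} ≤ claim i by
      calc W {i} * ℓ {i} ≤ W {i} * 1 := mul_le_mul_of_nonneg_left (hℓ1 i) hWinn
        _ = W {i} := mul_one _
        _ ≤ claim i := hmain
    -- the set relations of the charging scheme
    have hQle : ∀ k ∈ Q i, k ≤ i := by
      intro k hk
      simp only [hQ, mem_filter, mem_univ, true_and] at hk
      rcases hk with rfl | ⟨hlt, -⟩
      · exact le_refl _
      · exact le_of_lt hlt
    have hiQ : i ∈ Q i := by simp only [hQ, mem_filter, mem_univ, true_and]; exact Or.inl trivial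
    have hQM : ∀ k, k ∈ (Q i).erase i ↔ (k < i ∧ k ∈ M i) := by
      intro k
      simp only [mem_erase, hQ, hM, mem_filter, mem_univ, true_and]
      constructor
      · rintro ⟨hne, h | h⟩
        · exact absurd h hne
        · exact ⟨h.1, hne, h.2⟩
      · rintro ⟨hlt, -, ha⟩
        exact ⟨ne_of_lt hlt, Or.inr ⟨hlt, ha⟩⟩
    have hiM : i ∉ M i := by
      simp only [hM, mem_filter, mem_univ, true_and, not_and]
      exact fun h _ => h rfl
    have hiN : i ∈ Nv (d i) := by simp only [hNv, mem_filter, mem_univ, true_and]; exact Or.inl trivial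
    have hNM : (Nv (d i)).erase i ⊆ M i := by
      intro k hk
      simp only [mem_erase, hNv, mem_filter, mem_univ, true_and] at hk
      simp only [hM, mem_filter, mem_univ, true_and]
      refine ⟨hk.1, ?_⟩
      rcases hk.2 with h | h
      · exact Or.inl h
      · exact Or.inr (Or.inr (Or.inl h))
    have hsf := forest_sufficiency θ hθ0 hθ1 i (Q i) (M i) (Nv (d i)) hQle hiQ hQM hiM hiN hNM
    rw [hWi]
    rcases hlonely i hℓi with htA | htB
    · have htB : ¬ tB i := fun h => hAB i i htA h (Or.inl rfl)
      simp only [hclaim, htA, htB, if_true, if_false, add_zero]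
      exact hsf.1
    · have htA : ¬ tA i := fun h => hAB i i h htB (Or.inl rfl)
      simp only [hclaim, htA, htB, if_true, if_false, zero_add]
      exact hsf.2
  -- (III) assemble
  have hL : ∑ σ ∈ (univ : Finset ι).powerset, W σ * ℓ σ = ∑ i, W {i} * ℓ {i} := by
    have hsub : (univ : Finset ι).powersetCard 1 ⊆ (univ : Finset ι).powerset :=
      fun σ hσ => mem_powerset.2 (mem_powersetCard.1 hσ).1
    rw [← sum_subset hsub]
    · rw [powersetCard_one, sum_map]
      rfl
    · intro σ _ hσ
      have hne : ∀ i, σ ≠ {i} := by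
        intro i h
        apply hσ
        rw [mem_powersetCard]
        exact ⟨subset_univ _, by rw [h, card_singleton]⟩
      rw [hℓ0 σ hne, mul_zero]
  have hlhs : ∑ i, c i * ∑ σ ∈ (univ : Finset ι).powerset, W σ * (g σ - sp (d i) σ) = (∑ i, c i) * G - ∑ i, c i * R (d i) := by
    rw [Finset.sum_mul, ← Finset.sum_sub_distrib]
    refine sum_congr rfl fun i _ => ?_
    rw [← mul_sub]
    congr 1
    rw [hG, hR, ← Finset.sum_sub_distrib]
    exact sum_congr rfl fun σ _ => by ring
  have hrhs : ∑ σ ∈ (univ : Finset ι).powerset, W σ * (g σ - ℓ σ) = G - ∑ i, W {i} * ℓ {i} := by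
    rw [← hL, hG, ← Finset.sum_sub_distrib]
    exact sum_congr rfl fun σ _ => by ring
  rw [hlhs, hrhs, hcsum]
  have h1 : ∑ i, W {i} * ℓ {i} ≤ ∑ i, c i * R (d i) := le_trans (sum_le_sum fun i _ => hsuff i) hbudget
  nlinarith [h1, hGnn, hPnn, mul_nonneg hPnn hGnn]

end StarSet

end Summit.CriticalPhenomena.PercolationContinuityZ3.Theorems
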